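import Literature.Analysis.Asymptotics.MonomialAmplitudeAsymptotics
import HarnessLib

/-!
# Positivity of the leading coefficient and the Laplace form (monomial phase with amplitude)

Completion of the amplitude version of the elementary (monomial) asymptotics
(Lin 2017, Prop. 2.1; AGV II §7.2, Lemma 7.5 (1), Thm. 7.3 (4)): with the notation of
`MonomialAmplitudeAsymptotics.lean`,

* `toReal_measure_sublevel_inter_smallCube_ge` : scaling the cube, `vol_w(A_t ∩ (0,c]^d) ≥
  c^{∑ w_j} vol_w(A_t)` for `0 < c ≤ 1` (from the change of variables `x = c x'`, under which
  `x^{w-1}dx` becomes `c^{-w} x'^{w-1} dx'` on `(0,c]`);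
* `tendsto_amplitude_pos` : for a continuous amplitude `ψ ≥ 0` on `[0,1]^d` with `ψ(0) > 0` the
  limit `c_ψ = lim ∫_{A_t} ψ dvol_w / (t^λ (log 1/t)^{θ-1})` is POSITIVE (AGV Lemma 7.5 (1): the
  leading Laurent coefficient is positive for a non-negative amplitude positive at the origin);
* `tendsto_amplitude_laplace` : the Laplace form
  `(∫ e^{-β ∏|x_j|^{κ_j}} ψ dvol_w) β^λ/(log β)^{θ-1} → c_ψ Γ(λ+1)` as `β → ∞`.

Everything is PROVED; no definitions, no named facts.

## References

* S. Lin, arXiv:1003.5338, Prop. 2.1, Thm. 2.9. [Lin2017]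
* V. I. Arnold, S. M. Gusein-Zade, A. N. Varchenko, *Singularities of Differentiable Maps II*
  (2012), Part II §7.2, Lemma 7.5 (1), Thm. 7.3 (4). [ArnoldGuseinzadeVarchenko2012]
-/

noncomputable section

open MeasureTheory Filter Set Topology

open scoped ENNReal

namespace Literature.Analysis.Asymptotics.MonomialPhase

variable {d : ℕ}

/-! ## Scaling the cube -/

/-- `∫_{(0,m]} y^{ω-1} dy = m^ω/ω` (`ω, m > 0`). [folklore] -/
theorem lintegral_rpow_Ioc {ω : ℝ} (hω : 0 < ω) {m : ℝ} (hm : 0 < m) :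
    ∫⁻ y in Ioc 0 m, ENNReal.ofReal (y ^ (ω - 1)) = ENNReal.ofReal (m ^ ω / ω) := by
  have hint : IntegrableOn (fun x : ℝ => x ^ (ω - 1)) (Ioc 0 m) := by
    have h := intervalIntegral.intervalIntegrable_rpow' (a := 0) (b := m)
      (by linarith : (-1 : ℝ) < ω - 1)
    rw [intervalIntegrable_iff, uIoc_of_le hm.le] at h
    exact h
  rw [← ofReal_integral_eq_lintegral_ofReal hint ((ae_restrict_iff' measurableSet_Ioc).2
      (ae_of_all _ fun x hx => Real.rpow_nonneg hx.1.le _)),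
    ← intervalIntegral.integral_of_le hm.le, integral_rpow (Or.inl (by linarith)),
    Real.zero_rpow (by linarith), sub_zero, sub_add_cancel]

/-- **Scaling of the weight** `x^{ω-1}dx`: `x ↦ c x` carries `powMeasure ω` to
`c^{-ω} y^{ω-1} dy` on `(0, c]`. [folklore] -/
theorem measurePreserving_mul_left {ω : ℝ} (hω : 0 < ω) {c : ℝ} (hc : 0 < c) :
    MeasurePreserving (fun x : ℝ => c * x) (powMeasure ω)
      ((volume.restrict (Ioc (0 : ℝ) c)).withDensity fun y =>
        ENNReal.ofReal (c ^ (-ω) * y ^ (ω - 1))) := by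
  haveI := isFiniteMeasure_powMeasure hω
  have hf : Measurable fun x : ℝ => c * x := by fun_prop
  refine ⟨hf, Measure.ext_of_Iic _ _ fun a => ?_⟩
  rw [Measure.map_apply hf measurableSet_Iic]
  have hpre : (fun x : ℝ => c * x) ⁻¹' Iic a = Iic (a / c) := by
    ext x
    simp only [mem_preimage, mem_Iic]
    rw [le_div_iff₀ hc, mul_comm]
  rw [hpre, withDensity_apply _ measurableSet_Iic, Measure.restrict_restrict measurableSet_Iic]
  rcases le_or_gt a 0 with ha | ha
  · have h1 : powMeasure ω (Iic (a / c)) = 0 := by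
      rw [powMeasure_apply ω measurableSet_Iic]
      have hac : a / c ≤ 0 := div_nonpos_of_nonpos_of_nonneg ha hc.le
      have : Iic (a / c) ∩ Ioc (0 : ℝ) 1 = ∅ :=
        eq_empty_of_forall_notMem fun x hx => (hx.2.1.trans_le (hx.1.trans hac)).false
      rw [this, Measure.restrict_empty, lintegral_zero_measure]
    have h2 : Iic a ∩ Ioc (0 : ℝ) c = ∅ :=
      eq_empty_of_forall_notMem fun x hx => (hx.2.1.trans_le (hx.1.trans ha)).false
    rw [h1, h2, Measure.restrict_empty, lintegral_zero_measure]
  · have hset : Iic a ∩ Ioc (0 : ℝ) c = Ioc 0 (min a c) := by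
      ext x
      simp only [mem_inter_iff, mem_Iic, mem_Ioc, le_min_iff]
      tauto
    have hsplit : ∀ y : ℝ, ENNReal.ofReal (c ^ (-ω) * y ^ (ω - 1)) =
        ENNReal.ofReal (c ^ (-ω)) * ENNReal.ofReal (y ^ (ω - 1)) :=
      fun y => ENNReal.ofReal_mul (Real.rpow_nonneg hc.le _)
    rw [powMeasure_Iic hω (div_pos ha hc), hset]
    simp_rw [hsplit]
    rw [lintegral_const_mul _ (by fun_prop), lintegral_rpow_Ioc hω (lt_min ha hc),
      ← ENNReal.ofReal_mul (Real.rpow_nonneg hc.le _)]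
    congr 1
    rw [show min (a / c) 1 = min a c / c by rw [← div_self hc.ne', min_div_div_right hc.le],
      Real.div_rpow (lt_min ha hc).le hc.le, Real.rpow_neg hc.le]
    field_simp

/-- **Scaling of the cube weight**: for `0 < c ≤ 1` and measurable `S`,
`vol_w {x | c x ∈ S} = (∏ c^{-w_j}) vol_w (S ∩ (0,c]^d)`. [folklore] -/
theorem measure_smul_preimage {w : Fin d → ℝ} (hw : ∀ j, 0 < w j) {c : ℝ} (hc : 0 < c)
    (hc1 : c ≤ 1) {S : Set (Fin d → ℝ)} (hS : MeasurableSet S) :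
    (Measure.pi fun j => powMeasure (w j)) ((fun (x : Fin d → ℝ) (j : Fin d) => c * x j) ⁻¹' S) =
      (∏ j, ENNReal.ofReal (c ^ (-w j))) *
        (Measure.pi fun j => powMeasure (w j)) (S ∩ Set.pi univ fun _ => Ioc (0 : ℝ) c) := by
  haveI := sigmaFinite_powMeasure hw
  haveI : ∀ j, IsFiniteMeasure (powMeasure (w j)) := fun j => isFiniteMeasure_powMeasure (hw j)
  have hIoc : Ioc (0 : ℝ) c ∩ Ioc 0 1 = Ioc 0 c :=
    inter_eq_left.2 (Ioc_subset_Ioc le_rfl hc1)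
  -- the scaled factors are constant multiples of the restricted factors
  have hQeq : ∀ j, ((volume.restrict (Ioc (0 : ℝ) c)).withDensity fun y =>
      ENNReal.ofReal (c ^ (-w j) * y ^ (w j - 1))) =
      ((powMeasure (w j)).restrict (Ioc 0 c)).withDensity fun _ => ENNReal.ofReal (c ^ (-w j)) := by
    intro j
    rw [powMeasure_def, restrict_withDensity measurableSet_Ioc,
      Measure.restrict_restrict measurableSet_Ioc, hIoc,
      ← withDensity_mul _ (by fun_prop) (by fun_prop)]
    refine withDensity_congr_ae (ae_of_all _ fun y => ?_)
    simp only [Pi.mul_apply]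
    rw [ENNReal.ofReal_mul (Real.rpow_nonneg hc.le _), mul_comm]
  haveI hfin : ∀ j, SigmaFinite (((powMeasure (w j)).restrict (Ioc 0 c)).withDensity fun _ =>
      ENNReal.ofReal (c ^ (-w j))) := fun j => by
    rw [withDensity_const]
    refine @IsFiniteMeasure.toSigmaFinite _ _ _ ⟨?_⟩
    rw [Measure.smul_apply, smul_eq_mul]
    exact ENNReal.mul_lt_top ENNReal.ofReal_lt_top (measure_lt_top _ _)
  haveI : ∀ j, SigmaFinite ((volume.restrict (Ioc (0 : ℝ) c)).withDensity fun y =>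
      ENNReal.ofReal (c ^ (-w j) * y ^ (w j - 1))) := fun j => by
    rw [hQeq j]
    exact hfin j
  have hmp : MeasurePreserving (fun (x : Fin d → ℝ) (j : Fin d) => c * x j)
      (Measure.pi fun j => powMeasure (w j))
      (Measure.pi fun j => (volume.restrict (Ioc (0 : ℝ) c)).withDensity fun y =>
        ENNReal.ofReal (c ^ (-w j) * y ^ (w j - 1))) :=
    measurePreserving_pi _ _ fun j => measurePreserving_mul_left (hw j) hc
  rw [hmp.measure_preimage hS.nullMeasurableSet]
  have hpi : (Measure.pi fun j => (volume.restrict (Ioc (0 : ℝ) c)).withDensity fun y =>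
      ENNReal.ofReal (c ^ (-w j) * y ^ (w j - 1))) =
      (∏ j, ENNReal.ofReal (c ^ (-w j))) •
        (Measure.pi fun j => powMeasure (w j)).restrict (Set.pi univ fun _ => Ioc (0 : ℝ) c) := by
    rw [show (fun j => (volume.restrict (Ioc (0 : ℝ) c)).withDensity fun y =>
        ENNReal.ofReal (c ^ (-w j) * y ^ (w j - 1))) = fun j =>
        ((powMeasure (w j)).restrict (Ioc 0 c)).withDensity fun _ => ENNReal.ofReal (c ^ (-w j))
      from funext hQeq]
    have h := pi_withDensity_fin (fun j => (powMeasure (w j)).restrict (Ioc 0 c))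
      (fun j _ => ENNReal.ofReal (c ^ (-w j))) (fun j => measurable_const)
    rw [h, withDensity_const, Measure.restrict_pi_pi]
  rw [hpi, Measure.smul_apply, smul_eq_mul, Measure.restrict_apply hS]

/-- **The small cube carries a fixed fraction of the sublevel volume**: for `0 < c ≤ 1`,
`c^{∑ w_j} · vol_w {x^κ ≤ t} ≤ vol_w ({x^κ ≤ t} ∩ (0,c]^d)`. [folklore] -/
theorem toReal_measure_sublevel_inter_smallCube_ge (κ : Fin d → ℕ) {w : Fin d → ℝ}
    (hw : ∀ j, 0 < w j) {c : ℝ} (hc : 0 < c) (hc1 : c ≤ 1) (t : ℝ) :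
    (∏ j, c ^ w j) * ((Measure.pi fun j => powMeasure (w j))
        {x : Fin d → ℝ | ∏ j, x j ^ κ j ≤ t}).toReal ≤
      ((Measure.pi fun j => powMeasure (w j))
        ({x : Fin d → ℝ | ∏ j, x j ^ κ j ≤ t} ∩ Set.pi univ fun _ => Ioc (0 : ℝ) c)).toReal := by
  haveI := isFiniteMeasure_pi_powMeasure hw
  set μ : Measure (Fin d → ℝ) := Measure.pi fun j => powMeasure (w j) with hμ
  have hsub : ({x : Fin d → ℝ | ∏ j, x j ^ κ j ≤ t} ∩ Set.pi univ fun _ => Ioc (0 : ℝ) 1) ⊆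
      (fun (x : Fin d → ℝ) (j : Fin d) => c * x j) ⁻¹' {x : Fin d → ℝ | ∏ j, x j ^ κ j ≤ t} := by
    rintro x ⟨hx, hcube⟩
    simp only [mem_preimage, mem_setOf_eq] at hx ⊢
    have h0 : 0 ≤ ∏ j, x j ^ κ j :=
      Finset.prod_nonneg fun j _ => pow_nonneg (hcube j (mem_univ j)).1.le _
    have h1 : ∏ j, c ^ κ j ≤ 1 :=
      Finset.prod_le_one (fun j _ => pow_nonneg hc.le _) fun j _ => pow_le_one₀ hc.le hc1
    calc ∏ j, (c * x j) ^ κ j = (∏ j, c ^ κ j) * ∏ j, x j ^ κ j := by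
          rw [← Finset.prod_mul_distrib]
          exact Finset.prod_congr rfl fun j _ => mul_pow _ _ _
      _ ≤ 1 * ∏ j, x j ^ κ j := by gcongr
      _ ≤ t := by rwa [one_mul]
  have h4 : μ {x : Fin d → ℝ | ∏ j, x j ^ κ j ≤ t} ≤ (∏ j, ENNReal.ofReal (c ^ (-w j))) *
      μ ({x : Fin d → ℝ | ∏ j, x j ^ κ j ≤ t} ∩ Set.pi univ fun _ => Ioc (0 : ℝ) c) := by
    rw [hμ, pi_powMeasure_apply_eq_inter hw _ (measurableSet_sublevel κ t),
      ← measure_smul_preimage hw hc hc1 (measurableSet_sublevel κ t)]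
    exact measure_mono hsub
  have h5 := ENNReal.toReal_mono (ENNReal.mul_ne_top
    (ENNReal.prod_ne_top fun j _ => ENNReal.ofReal_ne_top) (measure_ne_top _ _)) h4
  rw [ENNReal.toReal_mul, ENNReal.toReal_prod] at h5
  simp_rw [ENNReal.toReal_ofReal (Real.rpow_nonneg hc.le _)] at h5
  have hprod : (∏ j, c ^ w j) * ∏ j, c ^ (-w j) = 1 := by
    rw [← Finset.prod_mul_distrib]
    refine Finset.prod_eq_one fun j _ => ?_
    rw [← Real.rpow_add hc, add_neg_cancel, Real.rpow_zero]
  calc (∏ j, c ^ w j) * (μ {x : Fin d → ℝ | ∏ j, x j ^ κ j ≤ t}).toReal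
      ≤ (∏ j, c ^ w j) * ((∏ j, c ^ (-w j)) *
          (μ ({x : Fin d → ℝ | ∏ j, x j ^ κ j ≤ t} ∩ Set.pi univ fun _ => Ioc (0 : ℝ) c)).toReal) :=
        mul_le_mul_of_nonneg_left h5 (Finset.prod_nonneg fun j _ => Real.rpow_nonneg hc.le _)
    _ = (μ ({x : Fin d → ℝ | ∏ j, x j ^ κ j ≤ t} ∩ Set.pi univ fun _ => Ioc (0 : ℝ) c)).toReal := by
        rw [← mul_assoc, hprod, one_mul]

/-! ## Positivity of the limit -/

variable {κ : Fin d → ℕ} {w : Fin d → ℝ}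

/-- **Positivity of the leading coefficient** (AGV II §7.2, Lemma 7.5 (1); Lin 2017, Prop. 2.1):
for a continuous amplitude `ψ ≥ 0` on `[0,1]^d` with `ψ(0) > 0`, the limit
`c_ψ = lim_{t→0⁺} ∫_{x^κ ≤ t} ψ dvol_w / (t^λ (log 1/t)^{θ-1})` exists and is positive.
[cite: ArnoldGuseinzadeVarchenko2012, Part II §7.2 Lemma 7.5] [cite: Lin2017, Prop. 2.1] -/
theorem tendsto_amplitude_pos (hκ : κ ≠ 0) (hw : ∀ j, 0 < w j) (ψ : (Fin d → ℝ) → ℝ)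
    (hψ : Continuous ψ) (hψ0 : ∀ x ∈ Icc (0 : Fin d → ℝ) 1, 0 ≤ ψ x) (hψpos : 0 < ψ 0) :
    ∃ c : ℝ, 0 < c ∧ Tendsto (fun t : ℝ =>
      (∫ x in {x : Fin d → ℝ | ∏ j, x j ^ κ j ≤ t}, ψ x ∂(Measure.pi fun j => powMeasure (w j))) /
        (t ^ rlct κ w * Real.log t⁻¹ ^ (rlctMult κ w - 1))) (𝓝[>] 0) (𝓝 c) := by
  haveI := isFiniteMeasure_pi_powMeasure hw
  set μ : Measure (Fin d → ℝ) := Measure.pi fun j => powMeasure (w j) with hμ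
  obtain ⟨c, hc⟩ := tendsto_amplitude hκ hw ψ hψ
  obtain ⟨C, hC, hV⟩ := tendsto_sublevelVolume κ hw hκ
  -- `ψ ≥ ψ(0)/2` on a small cube `(0, c₀]^d`
  obtain ⟨δ, hδ, hδψ⟩ := Metric.continuousAt_iff.1 hψ.continuousAt (ψ 0 / 2) (by linarith)
  set c₀ : ℝ := min (δ / 2) 1 with hc₀
  have hc₀pos : 0 < c₀ := lt_min (by linarith) one_pos
  have hc₀1 : c₀ ≤ 1 := min_le_right _ _
  have hsmall : ∀ x ∈ Set.pi univ (fun _ : Fin d => Ioc (0 : ℝ) c₀), ψ 0 / 2 ≤ ψ x := by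
    intro x hx
    have hdist : dist x 0 < δ := by
      rw [dist_zero_right, pi_norm_lt_iff hδ]
      intro j
      rw [Real.norm_eq_abs, abs_of_pos (hx j (mem_univ j)).1]
      exact (hx j (mem_univ j)).2.trans_lt (lt_of_le_of_lt (min_le_left _ _) (by linarith))
    have h := hδψ hdist
    rw [Real.dist_eq, abs_lt] at h
    linarith
  -- lower bound for the integrals
  set P : ℝ := ∏ j, c₀ ^ w j with hP
  have hPpos : 0 < P := Finset.prod_pos fun j _ => Real.rpow_pos_of_pos hc₀pos _
  have hlow : ∀ t, ψ 0 / 2 * (P * (μ {x : Fin d → ℝ | ∏ j, x j ^ κ j ≤ t}).toReal) ≤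
      ∫ x in {x : Fin d → ℝ | ∏ j, x j ^ κ j ≤ t}, ψ x ∂μ := by
    intro t
    have hAm := measurableSet_sublevel κ t
    have hBm : MeasurableSet ({x : Fin d → ℝ | ∏ j, x j ^ κ j ≤ t} ∩
        Set.pi univ fun _ => Ioc (0 : ℝ) c₀) :=
      hAm.inter (MeasurableSet.univ_pi fun _ => measurableSet_Ioc)
    calc ψ 0 / 2 * (P * (μ {x : Fin d → ℝ | ∏ j, x j ^ κ j ≤ t}).toReal)
        ≤ ψ 0 / 2 * (μ ({x : Fin d → ℝ | ∏ j, x j ^ κ j ≤ t} ∩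
            Set.pi univ fun _ => Ioc (0 : ℝ) c₀)).toReal := by
          gcongr
          exact toReal_measure_sublevel_inter_smallCube_ge κ hw hc₀pos hc₀1 t
      _ = μ.real ({x : Fin d → ℝ | ∏ j, x j ^ κ j ≤ t} ∩ Set.pi univ fun _ => Ioc (0 : ℝ) c₀) •
            (ψ 0 / 2) := by
          rw [smul_eq_mul, measureReal_def, mul_comm]
      _ ≤ ∫ x in {x : Fin d → ℝ | ∏ j, x j ^ κ j ≤ t} ∩ Set.pi univ (fun _ => Ioc (0 : ℝ) c₀),
            ψ x ∂μ :=
          setIntegral_ge_of_const_le hBm (measure_ne_top _ _) (fun x hx => hsmall x hx.2)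
            (integrable_of_continuous hw hψ).integrableOn
      _ ≤ ∫ x in {x : Fin d → ℝ | ∏ j, x j ^ κ j ≤ t}, ψ x ∂μ :=
          setIntegral_mono_set (integrable_of_continuous hw hψ).integrableOn
            (ae_restrict_of_ae ((ae_mem_cube hw).mono fun x hx => hψ0 x (cube_subset_Icc hx)))
            (Eventually.of_forall inter_subset_left)
  -- compare the limits
  have hlog : Tendsto (fun t : ℝ => Real.log t⁻¹) (𝓝[>] 0) atTop :=
    Real.tendsto_log_atTop.comp tendsto_inv_nhdsGT_zero
  have hlim : Tendsto (fun t : ℝ => ψ 0 / 2 * (P * ((μ {x : Fin d → ℝ | ∏ j, x j ^ κ j ≤ t}).toReal /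
      (t ^ rlct κ w * Real.log t⁻¹ ^ (rlctMult κ w - 1))))) (𝓝[>] 0)
      (𝓝 (ψ 0 / 2 * (P * C))) :=
    (hV.const_mul P).const_mul _
  refine ⟨c, lt_of_lt_of_le (by positivity) (le_of_tendsto_of_tendsto hlim hc ?_), hc⟩
  filter_upwards [self_mem_nhdsWithin, hlog.eventually (eventually_gt_atTop 0)] with t
    (ht : 0 < t) hL
  have hNt : 0 < t ^ rlct κ w * Real.log t⁻¹ ^ (rlctMult κ w - 1) :=
    mul_pos (Real.rpow_pos_of_pos ht _) (pow_pos hL _)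
  rw [← mul_div_assoc, ← mul_div_assoc]
  exact div_le_div_of_nonneg_right (hlow t) hNt.le

/-! ## The Laplace form -/

/-- **Asymptotics of the Laplace integral of a monomial phase with a continuous non-negative
amplitude** (AGV II §7.2 Thm. 7.3 (4); Lin 2017, Prop. 2.1 with Thm. 2.9): if
`∫_{x^κ ≤ t} ψ dvol_w / (t^λ (log 1/t)^{θ-1}) → c` then
`(∫ e^{-β ∏|x_j|^{κ_j}} ψ dvol_w) · β^λ/(log β)^{θ-1} → c Γ(λ+1)` as `β → ∞`.
[cite: ArnoldGuseinzadeVarchenko2012, Part II §7.2 Thm. 7.3] [cite: Lin2017, Thm. 2.9] -/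
theorem tendsto_amplitude_laplace (hκ : κ ≠ 0) (hw : ∀ j, 0 < w j) (ψ : (Fin d → ℝ) → ℝ)
    (hψ : Continuous ψ) (hψ0 : ∀ x ∈ Icc (0 : Fin d → ℝ) 1, 0 ≤ ψ x) {c : ℝ}
    (hc : Tendsto (fun t : ℝ =>
      (∫ x in {x : Fin d → ℝ | ∏ j, x j ^ κ j ≤ t}, ψ x ∂(Measure.pi fun j => powMeasure (w j))) /
        (t ^ rlct κ w * Real.log t⁻¹ ^ (rlctMult κ w - 1))) (𝓝[>] 0) (𝓝 c)) :
    Tendsto (fun β : ℝ =>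
      (∫ x, Real.exp (-(β * ∏ j, |x j| ^ κ j)) * ψ x ∂(Measure.pi fun j => powMeasure (w j))) *
        β ^ rlct κ w / Real.log β ^ (rlctMult κ w - 1)) atTop
      (𝓝 (c * Real.Gamma (rlct κ w + 1))) := by
  haveI := isFiniteMeasure_pi_powMeasure hw
  set μ : Measure (Fin d → ℝ) := Measure.pi fun j => powMeasure (w j) with hμ
  have hψint : Integrable ψ μ := integrable_of_continuous hw hψ
  have hψae : 0 ≤ᵐ[μ] ψ := (ae_mem_cube hw).mono fun x hx => hψ0 x (cube_subset_Icc hx)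
  -- the amplitude as a density
  set ν : Measure (Fin d → ℝ) := μ.withDensity fun x => ENNReal.ofReal (ψ x) with hν
  haveI : IsFiniteMeasure ν := isFiniteMeasure_withDensity_ofReal hψint.hasFiniteIntegral
  have hS : Measurable fun x : Fin d → ℝ => ∏ j, |x j| ^ κ j := by fun_prop
  have hS0 : ∀ x : Fin d → ℝ, 0 ≤ ∏ j, |x j| ^ κ j :=
    fun x => Finset.prod_nonneg fun j _ => pow_nonneg (abs_nonneg _) _
  -- sublevel volumes of `ν` are the amplitude integrals
  have hset : ∀ t : ℝ, (ν {x | ∏ j, |x j| ^ κ j ≤ t}).toReal =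
      ∫ x in {x : Fin d → ℝ | ∏ j, x j ^ κ j ≤ t}, ψ x ∂μ := by
    intro t
    have hm : MeasurableSet {x : Fin d → ℝ | ∏ j, |x j| ^ κ j ≤ t} :=
      measurableSet_le hS measurable_const
    rw [hν, withDensity_apply _ hm, ← ofReal_integral_eq_lintegral_ofReal hψint.integrableOn
      (ae_restrict_of_ae hψae), ENNReal.toReal_ofReal (integral_nonneg_of_ae
      (ae_restrict_of_ae hψae))]
    refine setIntegral_congr_set ?_
    refine (ae_mem_cube hw).mono fun x hx => ?_
    have h : ∏ j, |x j| ^ κ j = ∏ j, x j ^ κ j :=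
      Finset.prod_congr rfl fun j _ => by rw [abs_of_pos (hx j (mem_univ j)).1]
    simp only [eq_iff_iff]
    change (∏ j, |x j| ^ κ j ≤ t) ↔ (∏ j, x j ^ κ j ≤ t)
    rw [h]
  have hV : Tendsto (fun t : ℝ => (ν {x | ∏ j, |x j| ^ κ j ≤ t}).toReal /
      (t ^ rlct κ w * Real.log t⁻¹ ^ (rlctMult κ w - 1))) (𝓝[>] 0) (𝓝 c) := by
    simp_rw [hset]
    exact hc
  have h := LaplacePowerLog.tendsto_laplace_mul_rpow_div_log_pow (μ := ν) hS hS0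
    (rlct_pos hκ hw).le hV
  refine h.congr' (Eventually.of_forall fun β => ?_)
  congr 2
  rw [hν, integral_withDensity_eq_integral_toReal_smul (by fun_prop)
    (ae_of_all _ fun x => ENNReal.ofReal_lt_top)]
  refine integral_congr_ae (hψae.mono fun x hx => ?_)
  simp only [Pi.zero_apply] at hx
  dsimp only
  rw [ENNReal.toReal_ofReal hx, smul_eq_mul, mul_comm]

end Literature.Analysis.Asymptotics.MonomialPhase

end
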